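import Literature.NumberTheory.EllipticCurves.GaloisStableDivisibleSubgroupProofs
import Literature.NumberTheory.EllipticCurves.PrimaryGroupStableImage
import Literature.NumberTheory.EllipticCurves.WeilPairingProofs
import Literature.NumberTheory.EllipticCurves.SelmerPInftyRestriction
import Literature.NumberTheory.EllipticCurves.ZpExtensionProofs
import Literature.NumberTheory.EllipticCurves.HeegnerPointsImaginaryQuadraticProofs
import Literature.NumberTheory.EllipticCurves.Rank1Residual.Predicates
import Literature.NumberTheory.GaloisRepresentations.ImaginaryQuadraticCyclotomicProofs
import Literature.NumberTheory.QuadraticFields.DiscriminantOfSqrt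
import Summits.BirchSwinnertonDyer.BirchSwinnertonDyer.Theorems.SchneiderFreeAdditiveX3AnticyclotomicTorsionLayers
import HarnessLib

/-!
# `E(K_∞^{ac})[2^∞]` is finite for every `E/ℚ`, `K` imaginary quadratic, `K_∞^{ac}/K` the anticyclotomic `ℤ₂`-extension
# (stub `stub_finGlob_two` of line `eisenstein_two_bdp_line`, crux `PrintCf2.SplitBadTwoRankOneOfFacts`, item 20368)

Cell `bsd-print-cf2`, seat `bsd-line-cf2-p1-w4` g0 (extra width seat; lead `bsd-line-cf2-p1` g6/g7; skeleton ff08fa12d70d1357).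
`--supports stmt-BirchSwinnertonDyer-20368` (helper). THEOREMS ONLY (0 definitions, 0 named facts, 0 `sorry`). BSD is proved
for no curve by any of this; no summit statement is proved by this seat.

The registered stub `stub_finGlob_two` (atom (Fin_glob) of the lead's control machine at `2`,
`EisensteinTwo.additiveControlOnTreeAt_two_of_finAtoms`, p625474) asks, for `W` in the class, `K` imaginary quadratic and `κ`
an anticyclotomic `ℤ₂`-extension of `K`, that `E(K_∞)[2^∞] = E_K[2^∞]^{Gal(K̄/K_∞)}` be FINITE. We prove it for EVERY elliptic
curve over `ℚ` (the class hypotheses are not used): `EisensteinTwo.stub_finGlob_two` has the registered name and signature verbatim. The odd-`p`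
sibling `finite_fixedPoints_kerSubgroup_of_isAnticyclotomic` (cell bsd-schneider) proves the sharper `E(K_∞^{ac})[p^∞] = E(K)[p^∞]`
from `μ_p ⊄ K`; both its cases break at `p = 2`, and `E(K_∞^{ac})[2^∞]` can exceed `E(K)[2^∞]`, but finiteness survives:

* §1 (any `E/ℚ`, any `p`, any `H ≤ Γ_ℚ` closed under conjugation): if `E[p^∞]^H` is infinite then `H` fixes every `E[p^k]`
  pointwise — the stable image `p^{j₀}·E[p^∞]^H` is a non-zero `p`-divisible `Γ_ℚ`-stable subgroup, hence contains every `E[p^k]`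
  by the tree's `geomTorsion_pow_le_of_stable_divisible` (no `Γ_ℚ`-stable divisible line: Shafarevich + `End_ℚ(E) = ℤ`); the tree's
  `smul_eq_self_of_mem_geomTorsion_of_infinite` is the case `H = Gal(ℚ̄/ℚ_∞)`.
* §2 (`p = 2`): `res(Gal(K̄/K_∞))` cannot fix `E[16]` pointwise. By the Weil pairing `e₁₆` (`exists_weilPairing_holds`) it would fix
  a root of unity `ζ` of order `16`; every `σ ∈ Γ_K` acts by `ζ ↦ ζ^a`, and the anticyclotomic relation (`σ'σ ∈ ker κ` for
  `res σ' = ρ (res σ) ρ⁻¹`, `ρ ∉ Γ_K`) forces `a² ≡ 1 (mod 16)`, so `√2 = ζ² + ζ¹⁴` is `Γ_K`-fixed and lies in `K`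
  (`Rat.exists_eq_of_forall_range_absGaloisRestrict_smul`): `d_K = 8` (`discr_eq_four_mul_of_sq_eq_intCast`) against `d_K < 0`.
* §3 `E[2^∞]^{res(ker κ)} ⊆ E(ℚ̄)` is finite (`res(ker κ)` is conjugation-closed: `exists_mem_kerSubgroup_absGaloisRestrict_eq_conj`);
  §4 transport to `E_K[2^∞](K̄)` along the equivariant `primaryBaseChangeEquiv`; §5 the registered signature.

References: [GreenbergLNM1716] §1 p. 62, §3 Lemma 3.1; [Brink2007] §II Prop. 1; [SilvermanAEC2009] Prop. III.8.1, Cor. III.6.4(b);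
[Marcus2018] Ch. 2 Thm. 1 (`d_{ℚ(√2)} = 8`).
-/

set_option autoImplicit false

-- D-0017 layout: summit = sub-problem, so `Summit.BirchSwinnertonDyer.BirchSwinnertonDyer.…` is the mandated namespace of Theorems files.
set_option linter.dupNamespace false

noncomputable section

open scoped Classical AddSubgroup

namespace Summit.BirchSwinnertonDyer.BirchSwinnertonDyer.Theorems.PrintCf2.EisensteinTwo

open WeierstrassCurve Field NumberField Literature.NumberTheory.EllipticCurves
  Literature.NumberTheory.GaloisRepresentations
  Summit.BirchSwinnertonDyer.BirchSwinnertonDyer.Theorems.SchneiderFreeAdditiveX3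

/-! ## §1. Over `ℚ̄`: an infinite `E[p^∞]^H`, `H` closed under conjugation, forces `H` to fix every `E[p^k]` -/

section Rational

variable (W : WeierstrassCurve ℚ) [W.IsElliptic] {p : ℕ} [Fact p.Prime]

/-- **If `E[p^∞]^H` is infinite then `H` fixes every `E[p^k]` pointwise**, for an elliptic curve `E/ℚ`, a prime
`p` and a subgroup `H ≤ Γ_ℚ` closed under conjugation (`g⁻¹ τ g ∈ H` for `τ ∈ H`). The stable image
`p^{j₀} B` of `B = E[p^∞]^H` (`PrimaryGroup.exists_powRange_succ_eq`) is an infinite, `p`-divisible,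
`Γ_ℚ`-stable subgroup of `E[p^∞]`, so contains every `E[p^k]` by `geomTorsion_pow_le_of_stable_divisible`
(no `Γ_ℚ`-stable `p`-divisible line). The tree's `smul_eq_self_of_mem_geomTorsion_of_infinite` is the case
`H = Gal(ℚ̄/ℚ_∞)`. [cite: GreenbergLNM1716, §3 p. 86 (Lemma 3.1)] -/
theorem smul_eq_self_of_mem_geomTorsion_of_infinite_of_conj (H : Subgroup (absoluteGaloisGroup ℚ))
    (hconj : ∀ (g : absoluteGaloisGroup ℚ), ∀ τ ∈ H, g⁻¹ * τ * g ∈ H)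
    (hinf : ¬ Finite (FixedPoints.addSubgroup H (geomPrimaryTorsion W p)))
    (k : ℕ) {τ : absoluteGaloisGroup ℚ} (hτ : τ ∈ H) {T : W.geomPoints}
    (hT : T ∈ geomTorsion W ((p ^ k : ℕ) : ℤ)) : τ • T = T := by
  have hp : p.Prime := Fact.out
  set M : AddSubgroup W.geomPoints := geomPrimaryTorsion W p with hM
  set B : AddSubgroup M := FixedPoints.addSubgroup H M with hB
  -- `B` is `Γ_ℚ`-stable (conjugation-closedness of `H`)
  have hBstab : ∀ (σ : absoluteGaloisGroup ℚ) {m : M}, m ∈ B → σ • m ∈ B := by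
    intro σ m hm
    rw [hB, FixedPoints.mem_addSubgroup] at hm ⊢
    rintro ⟨τ, hτ⟩
    have h := hm ⟨σ⁻¹ * τ * σ, hconj σ τ hτ⟩
    rw [Subgroup.mk_smul] at h ⊢
    calc τ • σ • m = σ • ((σ⁻¹ * τ * σ) • m) := by rw [mul_smul, mul_smul, smul_inv_smul]
      _ = σ • m := by rw [h]
  -- `B` is `p`-primary with finite `p`-torsion
  have hprimB : ∀ b : B, ∃ k : ℕ, p ^ k • b = 0 := fun b ↦ by
    obtain ⟨k, hk⟩ := (b : M).2
    refine ⟨k, Subtype.ext (Subtype.ext ?_)⟩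
    simp only [AddSubmonoidClass.coe_nsmul, ZeroMemClass.coe_zero]
    exact hk
  haveI : Finite (geomTorsion W (p : ℤ)) := finite_geomTorsion_natCast W hp.ne_zero
  haveI : Finite ((B)[(p : ℕ)]) := by
    refine Finite.of_injective (fun x : (B)[(p : ℕ)] ↦
      (⟨(((x : B) : M) : W.geomPoints), ?_⟩ : geomTorsion W (p : ℤ))) ?_
    · refine AddSubgroup.torsionBy.nsmul_iff.mpr ?_
      have h := congrArg (fun b : B ↦ ((b : M) : W.geomPoints))
        (AddSubgroup.torsionBy.nsmul_iff.mp x.2)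
      simpa only [AddSubmonoidClass.coe_nsmul, ZeroMemClass.coe_zero] using h
    · intro x y hxy
      have h := congrArg Subtype.val hxy
      dsimp only at h
      exact Subtype.ext (Subtype.ext (Subtype.ext h))
  -- the stable image `D₀ = p^{j₀} B = p^{j₀+1} B`
  obtain ⟨j₀, hj₀⟩ := PrimaryGroup.exists_powRange_succ_eq p hprimB
  obtain ⟨t, ht⟩ := PrimaryGroup.exists_card_quotient_powRange_le p hprimB
  set D₀ : AddSubgroup B := (nsmulAddMonoidHom (p ^ j₀) : B →+ B).range with hD₀
  -- `D₀` is infinite (finite index in the infinite group `B`)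
  have hD₀inf : ¬ Finite D₀ := by
    intro hfin
    apply hinf
    haveI := (ht j₀).1
    refine Nat.finite_of_card_ne_zero ?_
    rw [← AddSubgroup.card_mul_index D₀, AddSubgroup.index_eq_card]
    exact mul_ne_zero Nat.card_pos.ne' Nat.card_pos.ne'
  -- `D₀` is `p`-divisible
  have hdiv₀ : ∀ x ∈ D₀, ∃ y ∈ D₀, p • y = x := by
    rintro x hx
    have hx' : x ∈ (nsmulAddMonoidHom (p ^ (j₀ + 1)) : B →+ B).range := by rw [hj₀]; exact hx
    obtain ⟨c, rfl⟩ := hx'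
    refine ⟨p ^ j₀ • c, ⟨c, rfl⟩, ?_⟩
    change p • p ^ j₀ • c = p ^ (j₀ + 1) • c
    rw [pow_succ', mul_smul]
  -- transport to `E(ℚ̄)` along `B ≤ M ≤ E(ℚ̄)`
  set e : B →+ W.geomPoints := M.subtype.comp B.subtype with he_def
  have he : ∀ b : B, e b = ((b : M) : W.geomPoints) := fun _ ↦ rfl
  have he_inj : Function.Injective e := fun a b h ↦ Subtype.ext (Subtype.ext h)
  set D : AddSubgroup W.geomPoints := D₀.map e with hD
  have hprim : ∀ P ∈ D, ∃ k : ℕ, p ^ k • P = 0 := by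
    rintro _ ⟨b, -, rfl⟩
    obtain ⟨k, hk⟩ := hprimB b
    exact ⟨k, by rw [← map_nsmul, hk, map_zero]⟩
  have hdiv : ∀ P ∈ D, ∃ Q ∈ D, p • Q = P := by
    rintro _ ⟨b, hb, rfl⟩
    obtain ⟨c, hc, hcb⟩ := hdiv₀ b hb
    exact ⟨e c, ⟨c, hc, rfl⟩, by rw [← map_nsmul, hcb]⟩
  have hstab : ∀ (σ : absoluteGaloisGroup ℚ) (P : W.geomPoints), P ∈ D → σ • P ∈ D := by
    rintro σ _ ⟨b, ⟨c, rfl⟩, rfl⟩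
    set c' : B := ⟨σ • (c : M), hBstab σ c.2⟩ with hc'
    refine ⟨p ^ j₀ • c', ⟨c', rfl⟩, ?_⟩
    rw [map_nsmul, nsmulAddMonoidHom_apply, map_nsmul, smul_comm σ (p ^ j₀) (e c)]
    rfl
  have hne : D ≠ ⊥ := by
    intro hDbot
    apply hD₀inf
    haveI : Subsingleton D₀ := by
      refine ⟨fun x y ↦ Subtype.ext (he_inj ?_)⟩
      have hx : e (x : B) ∈ D := ⟨x, x.2, rfl⟩
      have hy : e (y : B) ∈ D := ⟨y, y.2, rfl⟩
      rw [hDbot, AddSubgroup.mem_bot] at hx hy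
      rw [hx, hy]
    infer_instance
  -- `E[p^k] ≤ D ≤ B`
  have hle : geomTorsion W ((p ^ k : ℕ) : ℤ) ≤ D :=
    W.geomTorsion_pow_le_of_stable_divisible hprim hdiv hstab hne k
  obtain ⟨b, -, hb⟩ := hle hT
  have hfix := (FixedPoints.mem_addSubgroup _ _ _).mp b.2 ⟨τ, hτ⟩
  rw [Subgroup.mk_smul] at hfix
  rw [← hb, he, ← primaryComponent.coe_smul, hfix]

end Rational

/-! ## §2. `p = 2`: `Gal(K̄/K_∞^{ac})` does not fix `E[16]` pointwise (Weil pairing `e₁₆`, `√2 ∉ K`) -/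

section Sixteen

variable (W : WeierstrassCurve ℚ) [W.IsElliptic]
  {K : Type} [Field K] [NumberField K] (κ : ZpExtension K 2)

/-- Residues `a (mod 16)` with `a² ≡ 1 (mod 16)` are `±1, ±7`. [folklore] -/
private theorem mod_sixteen_of_sq (a : ℕ) (ha : a < 16) (h : a * a % 16 = 1) :
    a = 1 ∨ a = 7 ∨ a = 9 ∨ a = 15 := by
  interval_cases a <;> simp_all

/-- **`Gal(ℚ̄/K_∞^{ac})` cannot fix `E[16]` pointwise** (`K` imaginary quadratic, `κ` an anticyclotomic
`ℤ₂`-extension of `K`, `E/ℚ` any elliptic curve). By the Weil pairing `e₁₆` (Silverman, *AEC*, III.8.1) it would fix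
a root of unity `ζ = e₁₆(S, T)` of order `16`; each `σ ∈ Γ_K` acts by `ζ ↦ ζ^a`, the conjugate `σ'`
(`res σ' = ρ (res σ) ρ⁻¹`, `ρ ∈ Γ_ℚ ∖ Γ_K`) acts by the same `a`, and `σ'σ ∈ ker κ` fixes `ζ`, so `a² ≡ 1 (mod 16)`;
hence `√2 = ζ² + ζ¹⁴` is `Γ_K`-invariant, lies in `K`, and `d_K = 8`, contradicting `d_K < 0`.
[cite: SilvermanAEC2009, Prop. III.8.1] [cite: Brink2007, §II Prop. 1] -/
theorem false_of_forall_kerSubgroup_smul_geomTorsion_sixteen (hK : IsImaginaryQuadratic K)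
    (hκ : κ.IsAnticyclotomic)
    (hfix : ∀ τ ∈ κ.kerSubgroup, ∀ T : geomTorsion W ((2 ^ 4 : ℕ) : ℤ),
      absGaloisRestrict ℚ K τ • (T : W.geomPoints) = T) : False := by
  -- the Weil pairing on `E[16]`
  have h16Q : ((2 ^ 4 : ℕ) : ℚ) ≠ 0 := by norm_num
  have h8Q : ((2 ^ 3 : ℕ) : ℚ) ≠ 0 := by norm_num
  obtain ⟨w, hpow, -, haddr, -, hnd, hgal⟩ := exists_weilPairing_holds W (2 ^ 4) (by norm_num) h16Q
  have hne : ∀ S T, w S T ≠ 0 := fun S T h0 ↦ by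
    have := hpow S T
    rw [h0, zero_pow (by norm_num)] at this
    exact zero_ne_one this
  have hzero_right : ∀ S, w S 0 = 1 := fun S ↦ by
    have h := haddr S 0 0
    rw [add_zero] at h
    exact (mul_eq_left₀ (hne S 0)).mp h.symm
  have hnsmul_right : ∀ (a : ℕ) S T, w S (a • T) = w S T ^ a := fun a S T ↦ by
    induction a with
    | zero => rw [zero_nsmul, pow_zero, hzero_right]
    | succ a ih => rw [succ_nsmul, haddr, ih, pow_succ]
  -- a point `T ∈ E[16]` with `8 • T ≠ 0` (`#E[16] = 256 > 64 = #E[8]`)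
  obtain ⟨T, hT⟩ : ∃ T : geomTorsion W ((2 ^ 4 : ℕ) : ℤ), (2 ^ 3) • T ≠ 0 := by
    by_contra h
    push Not at h
    have hsub : geomTorsion W ((2 ^ 4 : ℕ) : ℤ) ≤ geomTorsion W ((2 ^ 3 : ℕ) : ℤ) := fun x hx ↦ by
      refine AddSubgroup.torsionBy.nsmul_iff.mpr ?_
      have := congrArg Subtype.val (h ⟨x, hx⟩)
      simpa only [AddSubmonoidClass.coe_nsmul, ZeroMemClass.coe_zero] using this
    haveI : Finite (geomTorsion W ((2 ^ 3 : ℕ) : ℤ)) := finite_geomTorsion_natCast W (by norm_num)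
    have hcard := AddSubgroup.card_le_of_le hsub
    rw [natCard_geomTorsion_eq_sq W h16Q, natCard_geomTorsion_eq_sq W h8Q] at hcard
    norm_num at hcard
  -- `S` with `e(S, 8T) ≠ 1`: `ζ = e(S, T)` has `ζ¹⁶ = 1`, `ζ⁸ ≠ 1`
  obtain ⟨S, hS⟩ : ∃ S, w S ((2 ^ 3) • T) ≠ 1 := by
    by_contra h
    push Not at h
    exact hT (hnd _ h)
  set ζ := w S T with hζ
  have hζ8 : ζ ^ (2 ^ 3) ≠ 1 := by rw [hζ, ← hnsmul_right]; exact hS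
  have hζ16 : ζ ^ (2 ^ 4) = 1 := hpow S T
  have hζ16' : ζ ^ 16 = 1 := by norm_num at hζ16; exact hζ16
  have hord' : orderOf ζ = 16 := by rw [orderOf_eq_prime_pow hζ8 hζ16]; norm_num
  -- every element of `Γ_ℚ` acts on `ζ` by a power
  have hprim : IsPrimitiveRoot ζ 16 := by rw [← hord']; exact IsPrimitiveRoot.orderOf ζ
  have hpow_act : ∀ g : absoluteGaloisGroup ℚ, ∃ a : ℕ, a < 16 ∧ g • ζ = ζ ^ a := by
    intro g
    have h1 : (g • ζ) ^ 16 = 1 := by rw [← smul_pow', hζ16', smul_one]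
    obtain ⟨a, ha, hga⟩ := hprim.eq_pow_of_pow_eq_one h1
    exact ⟨a, ha, hga.symm⟩
  -- `res(ker κ)` fixes `ζ`
  have hfixζ : ∀ τ ∈ κ.kerSubgroup, absGaloisRestrict ℚ K τ • ζ = ζ := by
    intro τ hτ
    have hS' : absGaloisRestrict ℚ K τ • S = S := Subtype.ext (by
      rw [Literature.NumberTheory.EllipticCurves.AddSubgroup.torsionBy.coe_smul]; exact hfix τ hτ S)
    have hT' : absGaloisRestrict ℚ K τ • T = T := Subtype.ext (by
      rw [Literature.NumberTheory.EllipticCurves.AddSubgroup.torsionBy.coe_smul]; exact hfix τ hτ T)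
    rw [hζ, hgal, hS', hT']
  -- a lift `ρ₀` of complex conjugation, not in `Γ_K`
  haveI : IsTotallyComplex K := hK.2
  obtain ⟨ρ₀, hρ₀, -⟩ := exists_not_mem_range_absGaloisRestrict (K := ℚ) (L := K)
    (Rat.castHom ℝ) (fun v ↦ IsTotallyComplex.isComplex v)
  -- `u = ζ² + ζ¹⁴ = √2` is fixed by `Γ_K`
  obtain ⟨u, hu⟩ : ∃ u : AlgebraicClosure ℚ, u = ζ ^ 2 + ζ ^ 14 := ⟨_, rfl⟩
  have hζpow : ∀ m : ℕ, ζ ^ m = ζ ^ (m % 16) := fun m ↦ by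
    rw [← hord', pow_mod_orderOf]
  have hfixu : ∀ σ : absoluteGaloisGroup K, absGaloisRestrict ℚ K σ • u = u := by
    intro σ
    obtain ⟨a, ha16, ha⟩ := hpow_act (absGaloisRestrict ℚ K σ)
    obtain ⟨b, -, hb⟩ := hpow_act ρ₀⁻¹
    obtain ⟨σ', hσ'⟩ := exists_absGaloisRestrict_eq_conj hK.1 ρ₀ σ
    have hmem : σ' * σ ∈ κ.kerSubgroup := mul_mem_kerSubgroup_of_isAnticyclotomic κ hκ hρ₀ hσ'
    -- `res σ'` acts on `ζ` by the same exponent `a`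
    have ha' : absGaloisRestrict ℚ K σ' • ζ = ζ ^ a := by
      rw [hσ', mul_smul, mul_smul, hb, smul_pow' _ ζ b, ha, ← pow_mul, mul_comm a b, pow_mul, ← hb,
        smul_pow', smul_inv_smul]
    -- `ζ = res(σ'σ) ζ = ζ^{a²}`, so `a² ≡ 1 (mod 16)`
    have hsq : ζ ^ (a * a % 16) = ζ ^ 1 := by
      rw [← hζpow, pow_one]
      conv_rhs => rw [← hfixζ _ hmem, map_mul, mul_smul, ha, smul_pow', ha', ← pow_mul]
    have hsq' : a * a % 16 = 1 := hprim.pow_inj (Nat.mod_lt _ (by norm_num)) (by norm_num) hsq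
    -- hence `a ∈ {1, 7, 9, 15}` and `res σ` fixes `u`
    have hact : absGaloisRestrict ℚ K σ • u = ζ ^ (a * 2) + ζ ^ (a * 14) := by
      rw [hu, smul_add, smul_pow' _ ζ 2, smul_pow' _ ζ 14, ha, ← pow_mul, ← pow_mul]
    rw [hact, hζpow (a * 2), hζpow (a * 14)]
    rcases mod_sixteen_of_sq a ha16 hsq' with rfl | rfl | rfl | rfl <;>
      simp only [Nat.reduceMul, Nat.reduceMod] <;> rw [hu] <;> exact add_comm _ _
  -- `u² = 2` (`ζ⁸ = -1`)
  have hζ8' : ζ ^ 8 = -1 := by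
    have h8 : ζ ^ 8 ≠ 1 := by norm_num at hζ8; exact hζ8
    have hsq : ζ ^ 8 * ζ ^ 8 = 1 := by rw [← pow_add]; exact hζ16'
    rcases mul_self_eq_one_iff.mp hsq with h | h
    · exact (h8 h).elim
    · exact h
  have hu2 : u ^ 2 = 2 := by
    have h14 : ζ ^ 14 = ζ ^ 8 * ζ ^ 6 := by rw [← pow_add]
    have h16 : ζ ^ 16 = 1 := hζ16'
    have h12 : ζ ^ 12 = ζ ^ 8 * ζ ^ 4 := by rw [← pow_add]
    have key : u ^ 2 = ζ ^ 4 + 2 * ζ ^ 16 + ζ ^ 16 * ζ ^ 12 := by rw [hu]; ring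
    rw [key, h16, h12, hζ8']
    ring
  -- so `u = √2 ∈ K`, and `d_K = 8`
  have hfixK : ∀ g ∈ ((absGaloisRestrict ℚ K).range : Subgroup (absoluteGaloisGroup ℚ)), g • u = u := by
    rintro _ ⟨σ, rfl⟩
    exact hfixu σ
  obtain ⟨emb, z, hz⟩ := Rat.exists_eq_of_forall_range_absGaloisRestrict_smul K hfixK
  have hz2 : z ^ 2 = ((2 : ℤ) : K) := by
    apply (emb : K →+* AlgebraicClosure ℚ).injective
    rw [map_pow, map_intCast]
    change emb z ^ 2 = _
    rw [hz, hu2]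
    norm_num
  have hdisc : NumberField.discr K = 4 * 2 :=
    Literature.NumberTheory.QuadraticFields.Quadratic.discr_eq_four_mul_of_sq_eq_intCast hK.1 hz2
      (Or.inl (by norm_num)) (by exact_mod_cast Int.prime_two.squarefree)
  have hneg := hK.discr_neg
  rw [hdisc] at hneg
  norm_num at hneg

end Sixteen

/-! ## §3. Over `ℚ̄`: `E[2^∞]^{res(Gal(K̄/K_∞^{ac}))}` is finite -/

section RationalTwo

variable (W : WeierstrassCurve ℚ) [W.IsElliptic]
  {K : Type} [Field K] [NumberField K] (κ : ZpExtension K 2)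

/-- **`E[2^∞]^{res(Gal(K̄/K_∞^{ac}))} ⊆ E(ℚ̄)` is finite** for every elliptic curve `E/ℚ`, `K` imaginary
quadratic and `κ` an anticyclotomic `ℤ₂`-extension of `K`: `res(ker κ)` is closed under `Γ_ℚ`-conjugation
(`K_∞^{ac}/ℚ` is Galois, `exists_mem_kerSubgroup_absGaloisRestrict_eq_conj`), so were the fixed group infinite
it would fix `E[16]` pointwise (§1), which §2 excludes. [cite: GreenbergLNM1716, §1 p. 62; §3 p. 86] -/
theorem finite_fixedPoints_map_kerSubgroup_geomPrimaryTorsion_two (hK : IsImaginaryQuadratic K)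
    (hκ : κ.IsAnticyclotomic) :
    Finite (FixedPoints.addSubgroup (κ.kerSubgroup.map (absGaloisRestrict ℚ K).toMonoidHom)
      (geomPrimaryTorsion W 2)) := by
  by_contra hinf
  set N' : Subgroup (absoluteGaloisGroup ℚ) := κ.kerSubgroup.map (absGaloisRestrict ℚ K).toMonoidHom
    with hN'
  have hconj : ∀ (g : absoluteGaloisGroup ℚ), ∀ τ ∈ N', g⁻¹ * τ * g ∈ N' := by
    intro g τ hτ
    obtain ⟨τ₀, hτ₀, rfl⟩ := Subgroup.mem_map.mp hτ
    obtain ⟨τ', hτ', hres⟩ := exists_mem_kerSubgroup_absGaloisRestrict_eq_conj κ hK.1 hκ g⁻¹ hτ₀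
    rw [inv_inv] at hres
    exact Subgroup.mem_map.mpr ⟨τ', hτ', hres⟩
  refine false_of_forall_kerSubgroup_smul_geomTorsion_sixteen W κ hK hκ fun τ hτ T ↦ ?_
  exact smul_eq_self_of_mem_geomTorsion_of_infinite_of_conj W N' hconj hinf 4
    (Subgroup.mem_map.mpr ⟨τ, hτ, rfl⟩) T.2

end RationalTwo

/-! ## §4. Over `K`: `E(K_∞^{ac})[2^∞]` is finite -/

section OverK

variable (W : WeierstrassCurve ℚ) [W.IsElliptic]
  {K : Type} [Field K] [NumberField K] (κ : ZpExtension K 2)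

/-- **`E(K_∞^{ac})[2^∞]` is finite.** For every elliptic curve `E/ℚ`, every imaginary quadratic field `K` and
every anticyclotomic `ℤ₂`-extension `κ` of `K` (`K_∞ = K̄^{ker κ}`), the group
`B = E_K[2^∞]^{Gal(K̄/K_∞)} = E(K_∞)[2^∞]` is finite: transport of
`finite_fixedPoints_map_kerSubgroup_geomPrimaryTorsion_two` along the equivariant identification
`E[2^∞](ℚ̄) ≃ E_K[2^∞](K̄)` (`primaryBaseChangeEquiv`). The `p = 2` companion of the odd-`p`
`finite_fixedPoints_kerSubgroup_of_isAnticyclotomic` (which needs `μ_p ⊄ K`); it is the hypothesis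
`[Finite B]` of Greenberg's Lemma 4.3 / Theorem 4.1 counts at `p = 2` on the anticyclotomic tower.
[cite: GreenbergLNM1716, §1 p. 62; §3 p. 86] -/
theorem finite_fixedPoints_kerSubgroup_two_of_isAnticyclotomic (hK : IsImaginaryQuadratic K)
    (hκ : κ.IsAnticyclotomic) :
    Finite (FixedPoints.addSubgroup κ.kerSubgroup (geomPrimaryTorsion (W.baseChange K) 2)) := by
  haveI := finite_fixedPoints_map_kerSubgroup_geomPrimaryTorsion_two W κ hK hκ
  set N' : Subgroup (absoluteGaloisGroup ℚ) := κ.kerSubgroup.map (absGaloisRestrict ℚ K).toMonoidHom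
    with hN'
  let e := primaryBaseChangeEquiv K W 2
  have hequiv : ∀ (τ : absoluteGaloisGroup K) (P : geomPrimaryTorsion W 2),
      e (absGaloisRestrict ℚ K τ • P) = τ • e P :=
    fun τ P ↦ primaryBaseChangeEquiv_smul K W 2 τ P
  refine Finite.of_injective
    (fun m : FixedPoints.addSubgroup κ.kerSubgroup (geomPrimaryTorsion (W.baseChange K) 2) ↦
      (⟨e.symm (m : geomPrimaryTorsion (W.baseChange K) 2), ?_⟩ :
        FixedPoints.addSubgroup N' (geomPrimaryTorsion W 2))) ?_
  · rw [FixedPoints.mem_addSubgroup]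
    rintro ⟨g, hg⟩
    obtain ⟨τ, hτ, rfl⟩ := Subgroup.mem_map.mp hg
    rw [Subgroup.mk_smul]
    apply e.injective
    change e (absGaloisRestrict ℚ K τ • _) = _
    rw [hequiv, e.apply_symm_apply]
    have h := (FixedPoints.mem_addSubgroup _ _ _).mp m.2 ⟨τ, hτ⟩
    rwa [Subgroup.mk_smul] at h
  · intro m m' hmm'
    have h := congrArg (fun z : FixedPoints.addSubgroup N' (geomPrimaryTorsion W 2) ↦
      e (z : geomPrimaryTorsion W 2)) hmm'
    simp only [AddEquiv.apply_symm_apply] at h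
    exact Subtype.ext h

end OverK

/-! ## §5. The registered stub `stub_finGlob_two` of line `eisenstein_two_bdp_line` (skeleton ff08fa12d70d1357), verbatim -/

open Literature.NumberTheory.EllipticCurves.Rank1Residual in
/-- **Stub F1 `stub_finGlob_two` of crux `PrintCf2.SplitBadTwoRankOneOfFacts`, line `eisenstein_two_bdp_line`,
signature VERBATIM** (atom (Fin_glob) of `EisensteinTwo.additiveControlOnTreeAt_two_of_finAtoms`): for `W` in the
class (CM, analytic rank `1`, `2` split in the CM field, `2` bad — none of which is used), every imaginary
quadratic `K` and every anticyclotomic `ℤ₂`-extension `κ` of `K`, `E(K_∞)[2^∞]` is finite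
(`finite_fixedPoints_kerSubgroup_two_of_isAnticyclotomic`). [cite: GreenbergLNM1716, §1 p. 62; §3 p. 86] -/
theorem stub_finGlob_two :
    ∀ (W : WeierstrassCurve ℚ) [W.IsElliptic] [W.IsGloballyMinimal],
      W.HasCM → W.analyticRank = 1 → CMSplit W 2 → ¬ Good W 2 →
      ∀ (K : Type) [Field K] [NumberField K], IsImaginaryQuadratic K →
        ∀ (κ : ZpExtension K 2), κ.IsAnticyclotomic →
          Finite (FixedPoints.addSubgroup κ.kerSubgroup (geomPrimaryTorsion (W.baseChange K) 2)) :=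
  fun W _ _ _ _ _ _ _ _ _ hK κ hκ ↦ finite_fixedPoints_kerSubgroup_two_of_isAnticyclotomic W κ hK hκ

end Summit.BirchSwinnertonDyer.BirchSwinnertonDyer.Theorems.PrintCf2.EisensteinTwo

end
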